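import Summits.BirchSwinnertonDyer.BirchSwinnertonDyer.Theses.GenusKolyvaginAtTwo
import Literature.NumberTheory.EllipticCurves.KolyvaginShaStructureIndexFormProofs
import Literature.NumberTheory.EllipticCurves.HeegnerPointsOfConductorOneRationalityProofs
import Literature.NumberTheory.EllipticCurves.HeegnerPointsOfConductorOneData
import Literature.NumberTheory.EllipticCurves.LFunctionSmulProofs
import Literature.NumberTheory.QuadraticFields.HeegnerCondition
import Literature.NumberTheory.EllipticCurves.ComplexMultiplicationHasCMProofs

/-!
# SKELETON `genus_supply` FOR CRUX 23660 `GenusDeepSupplyAtTwoNegDisc` (route rev 36/37 = (β″); LEAD gk2-p1 g18, 2026-08-29T20:0xZ)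
= the registered 22136 skeleton `Cruxes/GenusPrimitiveSupplyAtTwo/Lines/genus_supply.lean` v2.2 VERBATIM (stubs A `stub_minimalTwinSupplyAtTwo` — takes
`Odd W.tamagawaProduct`, outputs the DEF ≤ 2 guard —, B `stub_heegnerNonTorsionAtTwo` (print), C `stub_genusPrimitivityAtTwo` in GROSS currency), with the
composition retargeted to the new decl (text = 22136's with `W.Δ < 0 →` inserted and the three-conjunct witness clause): `intro … _hneg …`, pass `hKoly` whole.
BSD is NOT proved by any of this; nothing closed.
-/

/-!
# Crux `GenusPrimitiveSupplyAtTwo` (stmt-BirchSwinnertonDyer-22136), line `genus-supply` — reduction skeleton v1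

Lead prover seat bsd-line-gk2-p1 (g0, 2026-08-27). Route `GenusKolyvaginAtTwo` (DRAFT rev 2), crux #2 (rank 2, XL):
for every `E` in the habitat H (non-CM, `r_an = 0`, `ρ_{E,2^∞}` onto, odd Tamagawa product, an optimal
parametrisation with odd Manin constant) produce a Kolyvagin-(H2)-admissible Heegner field `K`, the conductor-`1`
Heegner datum `y_K` of infinite order with its exact `2`-divisibility exponent `M₀`, a square-free product `n` of
Kolyvagin primes at `2` with `P(n) ∉ 2E(K[n])`, and a globally minimal `2`-Selmer-minimal rank-`1` twin `E^{(d_K)}`.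

THE CUT (three registered stubs; everything else PROVED from the tree):
* **A** `stub_minimalTwinSupplyAtTwo` (the route's child MT, «Mazur–Rubin prime twisting» ∕ Goldfeld–Gross–Zagier
  supply): for non-CM `E` with `r_an = 0` and `ρ_{E,2^∞}` onto there is an imaginary quadratic `K` with odd
  `d_K ≠ −3`, the Heegner hypothesis for `N_E`, `d_K·(−Δ)` and `d_K·(−2Δ)` non-squares, and a globally minimal model
  `Wd ≅ E^{(d_K)}` with `r_an(Wd) = 1`, `#Sel₂(Wd) = 2`. OPEN as stated (Bump–Friedberg–Hoffstein ∕ Murty–Murty give `r_an(E^{(d_K)}) = 1` for infinitely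
  many Heegner `K`; `Sel₂ = ℤ/2` on top is a Mazur–Rubin ∕ Smith-type distribution statement restricted to Heegner
  discriminants — not in print in this conjunction).
* **B** `stub_heegnerNonTorsionAtTwo` (Gross–Zagier I.6.3 + `L(E/K,s) = L(E,s)L(E^{(d_K)},s)`): `r_an(E) = 0`,
  `r_an(E^{(d_K)}) = 1`, Heegner hypothesis ⟹ `y_K = P(1)` has infinite order. IN PRINT; dischargeable in the tree
  modulo the named facts `gross_zagier` + `hasEntireLFunction_rat` (this seat, next).
* **C** `stub_genusPrimitivityAtTwo` (the HEART = Gross's Question 11 at `p = 2`; the route's children GI «`D_ℓ ≡`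
  genus projector mod 2» + U «odd Heegner index of a 2-Selmer-minimal genus pair»): on H, for an admissible `K`, an
  optimal odd-Manin `Dt`, a conductor-`1` datum of infinite order and a `2`-Selmer-minimal rank-`1` twin, SOME
  square-free product `n` of Kolyvagin primes at `2` has `P(n) ∉ 2E(K[n])`. OPEN (W. Zhang's theorem is `p ≥ 5`).
GLUE PROVED HERE: the orientation `β` with `4N ∣ β² − d_K` (`exists_dvd_sq_sub_discr_of_ncard_primesOver`, Gross 1984
§3); an embedding `ι : K → ℂ` (Mathlib); the conductor-`1` datum (`exists_kolyvaginHeegnerData_one` ∘ Darmon Thm. 3.6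
PROVED `phi_heegnerTau_mem_singularModuliField_holds`); `r_an` of the twist from the minimal model `Wd`
(`analyticRank_smul`); the twin is non-CM (`j` is a twist and model invariant, `hasCM_iff_of_j_eq`); McCallum's `M₀ = ord₂(y_K)` EXISTS by Mordell–Weil over the number field `K[1]`
(`exists_pow_smul_eq_and_not_of_not_isOfFinAddOrder`, `numberField_ringClassField`, `module_finite_point_holds`).
`GenusPrimitiveSupplyAtTwo_of` concludes the crux BY NAME; sorries only in `stub_*`.

v2 (same lead, 2026-08-27T23:5xZ) — STATE OF THE STUBS after the first wave of helpers (all `--supports 22136`, tree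
namespace `Summit.BirchSwinnertonDyer.BirchSwinnertonDyer.Theorems.GenusKoly`):
* B is CLOSED MODULO PUBLISHED FACTS: `stub_heegnerNonTorsionAtTwo_of_published` (p580851; `hasEntireLFunction_rat`,
  `gross_zagier`).
* C is TRANSLATED (kernel-checked dictionary, no open input): for every square-free `n` of Kolyvagin primes at `2` and
  every datum `d`, `P(n) ∈ 2E(K[n]) ⟺ G⁺(n) ∈ 2E(K[n])` where `G⁺(n) = Σ_{s∈S} s(∏_{ℓ∣n} Σ_{i even ≤ ℓ} σ_ℓ^i · y(n))` is
  the MULTI-GENUS Heegner point (trace of `y(n)` to `K[1](√ℓ₁*,…,√ℓ_r*)` summed over `S`):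
  `heegner_exists_two_zsmul_eq_derivedPoint_iff_evenPart_of_kolyvagin` (`…GenusReductionComposite`, p585380), built on
  `…GenusIdentity` (p581179/p582120: `2·D_ℓ = Tr − Y_χ + 4Z`, `D_n ≡ ∏ Σ_{i odd} σ_ℓ^i`, `P(n) ≡ G(n) (mod 2)`) and
  `…GenusReduction` (p583668/p584626: prime level, `σ_ℓ` of order `ℓ+1`, transversality, Gross Prop. 3.7 (1) read in
  `E(K[n])`). So C ⟺ «∃ n, d: G⁺(n) ∉ 2E(K[n])» — Birch's lemma at `2` for full-`2`-image curves at composite genus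
  level (in print only for curves WITH rational `2`-torsion: Birch 1970, Coates–Li–Tian–Zhai 2015, Shu–Zhai
  arXiv:2102.11808; and via `2`-adic logarithms at split `2` for `E(ℚ)[2] = 0`: Kriz–Li 2019 Thm. 1.16/4.3).
* A is OPEN as stated (presearch: Kriz–Li Rem. 1.14 — the `2`-converse is not known; BFH/Murty–Murty give `r_an = 1`
  Heegner twists, Mazur–Rubin/Smith the Selmer side, not jointly).

v3 (same lead, 2026-08-28T00:4xZ; route OPEN, item claimed): + p585959 (C's two forms equivalent frame by frame),
p586550/p586841 `…GenusField` (prime level, INTRINSIC: `P(ℓ) ≡ Tr_{K[ℓ]/K(√ℓ*)} y(ℓ) (mod 2E(K[ℓ]))`, `θ = √ℓ*` from the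
named fact `sqrt_pStar_mem_ringClassField`). Stub A is data-true on all 591 WALL-row-1 habitat cells (census W52
ADDENDUM-1). Stubs unchanged: A OPEN · B CLOSED mod PUB · C OPEN (translated).

v4 (lead gk2-p1 g2, 2026-08-28T04:2xZ) — BOTH open stubs now have kernel-checked REDUCTIONS (all `--supports 22136`):
* A: p590220 `…TwinConverse` — `stub_minimalTwinSupplyAtTwo_of_twoConverse`: Modularity (`exists_isNewformOf`) ∧ `2`-parity
  (`p_parity · 2`, Dokchitser–Dokchitser) ∧ (CONV₂: the rank-one `2`-converse for non-CM curves = crux 19220 of route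
  `TwoAdicConverse`, by name in `…_of_rankOneTwoConverse`) ∧ (SUPPLY: some admissible Heegner twist is `2`-Selmer-minimal,
  Mazur–Rubin-type) ⟹ stub A VERBATIM; conversely A ⟹ SUPPLY. So A = SUPPLY modulo PUB + CONV₂: NOT independent of 19220.
* C: p590935 `…RingClassProduct` (`G_n = ∏ G_ℓ` as a multi-index bijection; genus radicals `√ℓ* ∈ K[n]` with sign table),
  p591240 `…MultiGenusAlgebra` (fixed part ≡ even part mod `2A`), p591643 `…MultiGenusField`: at EVERY square-free level,
  UNCONDITIONALLY and INTRINSICALLY, `P(n) ∈ 2E(K[n]) ⟺ Tr_{K[n]/K(√ℓ₁*,…,√ℓ_r*)} y(n) ∈ 2E(K[n])`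
  (`heegner_exists_two_zsmul_eq_derivedPoint_iff_multiGenusTrace`); stub C ⟺ «∃ n: the multi-genus Heegner point of conductor
  `n` is not `2`-divisible in `E(K[n])`» (both directions). The dictionary is complete; what remains of C is its arithmetic
  (Birch's lemma at `2` for full-`2`-image curves ∕ Kolyvagin's conjecture mod `2`), not bookkeeping.
Stubs: A OPEN (= SUPPLY + CONV₂) · B CLOSED mod PUB · C OPEN (= multi-genus `2`-primitivity). BSD is not proved by any of this.

v5 (lead gk2-p1 g2 + siblings gk2-p4/p5, 2026-08-28T06:3xZ) — THE CRUX BY NAME FROM ITS OPEN KERNELS: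
* gk2-p5 p591445 `…TwinSupply`: (SUPPLY) from PRINT (Mazur–Rubin 2010 Prop. 5.2 lowering, binder `hMR`; + Cassels–Tate,
  Dirichlet) ⟹ stub A = PRINT + CONV₂ (`stub_minimalTwinSupplyAtTwo_of_lowering_of_twoConverse`).
* gk2-p4 `…HeegnerNonTorsionOfGZ`: stub B modulo `gross_zagier` ALONE (`stub_heegnerNonTorsionAtTwo_of_grossZagier`).
* lead p592487/p592691 `…OfKernels`: `genusPrimitiveSupplyAtTwo_of_twoConverse_of_multiGenus` — the crux
  `GenusPrimitiveSupplyAtTwo` BY NAME from PRINT {`exists_isNewformOf`, `p_parity · 2`, `exists_casselsTate_pairing`, `hMR`,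
  `gross_zagier`} ∧ (CONV₂: `∀ V non-CM minimal, V.selmerCorank 2 = 1 → V.analyticRank = 1`, = crux 19220 widened) ∧ (U: in
  stub C's frame, `∃ n d θ T, … ¬∃Q, 2•Q = Σ_{g∈T} g·y(n)`, multi-genus `2`-primitivity); conditional-result.
* lead p592908 `…KolyvaginPrimes`: Gross's Kolyvagin primes at `2` (`FrobEqFrobInfty`) are Zhang's; the dictionary under the
  strong predicate (`…multiGenusTrace_of_gross`) — a restatement of the certificate clause along Gross's primes costs nothing.
* lead p593154/p593309 `…GenusDescent`: `P(n) ∈ 2E(K[n]) ⟺ Y_n` is twice a `T`-INVARIANT point (test inside the multi-quadratic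
  genus field `F_n`, degree `2^{r+1}`); `T` canonical (independent of the square roots); `(θ, T)` exists.
STATE: crux 22136 is OPEN exactly at (CONV₂) ∧ (U); every other input is PRINT or a tree theorem. Recommendation: type (U) as
the crux's child (`MultiGenusPrimitivityAtTwo`) and (CONV₂) as a support item (or 19220 + habitat reduction clause); then a
twin `GenusPrimitiveSupplyAtTwoOfKernels` closes by name in one line. BSD is not proved by any of this.
-/

set_option linter.dupNamespace false

noncomputable section

open scoped Classical

namespace Summit.BirchSwinnertonDyer.BirchSwinnertonDyer.Cruxes.GenusDeepSupplyAtTwoNegDisc.GenusSupply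

open WeierstrassCurve Literature.NumberTheory.EllipticCurves
  Literature.NumberTheory.EllipticCurves.ModularForms

/-! ## §1 The three stubs

**v2 (2026-08-29, LEAD gk2-p1 g18 — director-bsd g18 FOREST MOVE 12:18Z, ladder-directors/REQUESTS.md (386)(3)):** the bench seat
`prover-bench-stmt-BirchSwinnertonDyer-22136-genusPrimitivityAtTwo` found STUB C «∀K-form» BSD-inconsistent at genus defect `DEF(W, d_K) ≥ 3`
(corrected signature: a `DEF ≤ 2` / `DEF = 1` guard).  The guard is inserted in (E1) / Tamagawa currency, `padicValNat 2 Wd.tamagawaProduct ≤ 2`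
(= `DEF(W, d_K) = Σ_{p ∣ d_K} dim Ẽ(𝔽_p)[2]` by gk2-p3's `padicValNat_two_tamagawaProduct_twin_eq`; on `Δ < 0` it is odd by `stub_genusParity` of LINE 18,
so `≤ 2` means `= 1` there), placed where `Wd` is bound: STUB A now OUTPUTS it (its supply-side socket is gk2-p5's `…HabitatCutStubA` /
`supply_DEF1_minimalTwin_habitat`, delivered unconditionally on `dim Sel₂(E/ℚ) ≤ 2` — gk2-p5 g20; beyond that reach STUB A with the guard is OPEN and,
by the Mazur–Rubin Prop. 3.3 count, expected to FAIL: the route pen's (H1)/(E1) bookkeeping of director (347) applies), STUB C TAKES it, and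
`GenusPrimitiveSupplyAtTwo_of` threads it.  **v2.1 (16:1xZ, gk2-p5 g25's finding «stub-misstated»): STUB A also TAKES `Odd W.tamagawaProduct`**
(the crux's own habitat binder, passed by the composition) — without it the new output `padicValNat 2 Wd.tamagawaProduct ≤ 2` forces `ord₂ C(W) ≤ 2`, false e.g. at
3686d1 (`C(W) = 8`, r_an = 0, non-CM, 2-adic onto; gk2-p5 memo `Lines/genus-supply-stubA-guard-gk2p5.md`).  Nothing else changed.  BSD is NOT proved by any of this. -/

/-- STUB A — MINIMAL-TWIN SUPPLY ON THE HABITAT (route child MT). For `E` in H (non-CM, `r_an(E) = 0`, `ρ_{E,2^n}`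
onto for all `n ≥ 1`, odd Tamagawa product, an optimal parametrisation with odd Manin constant) there is an imaginary
quadratic field `K` with odd `d_K ≠ −3` satisfying the Heegner hypothesis for `N_E`, with `d_K·(−Δ_E)` and
`d_K·(−2Δ_E)` non-squares in `ℚ` (Kolyvagin's Theorem-B₂ exclusions), and a globally minimal model `Wd` of the twist
`E^{(d_K)}` of analytic rank `1` with `#Sel₂(Wd) = 2` (its non-CM is inherited from `E`, glue `not_hasCM_twin`).
Only the hypotheses that bear on twin supply are kept (`¬CM`, `r_an = 0`, `ρ_{E,2^n}` onto — so `E(ℚ)[2] = 0` and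
`Sel₂(E^{(d)}) ⊇ E^{(d)}(ℚ)/2` can be `ℤ/2` in rank `1`; the `2`-parity flips under a Heegner twist). OPEN as a
conjunction; sources: Mazur–Rubin 2010 Prop. 3.3 ∕ Thm. 1.4, Bump–Friedberg–Hoffstein 1990, Murty–Murty 1991,
Gross–Zagier 1986. [cite: GrossZagier1986, Thm. I.6.3] -/
theorem stub_minimalTwinSupplyAtTwo :
  ∀ (W : WeierstrassCurve ℚ) [W.IsElliptic] [W.IsGloballyMinimal] [NeZero (W.conductorNorm ℤ)],
    ¬ W.HasCM → W.analyticRank = 0 → (∀ n : ℕ, 0 < n → W.HasSurjectiveModNGaloisRep ((2 : ℤ) ^ n)) →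
    Odd W.tamagawaProduct →
    ∃ (K : Type) (_ : Field K) (_ : NumberField K),
      IsImaginaryQuadratic K ∧ Odd (NumberField.discr K) ∧ NumberField.discr K ≠ -3 ∧
      SatisfiesHeegnerHypothesis (W.conductorNorm ℤ) K ∧
      ¬ IsSquare ((NumberField.discr K : ℚ) * -|W.Δ|) ∧ ¬ IsSquare ((NumberField.discr K : ℚ) * (-(2 * |W.Δ|))) ∧
      ∃ (Wd : WeierstrassCurve ℚ) (_ : Wd.IsElliptic) (_ : Wd.IsGloballyMinimal),
        (∃ C : WeierstrassCurve.VariableChange ℚ, C • W.quadraticTwist (NumberField.discr K : ℚ) = Wd) ∧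
        Wd.analyticRank = 1 ∧ Nat.card (Wd.selmerGroup 2) = 2 ∧ padicValNat 2 Wd.tamagawaProduct ≤ 2
    := by
  sorry

/-- STUB B — HEEGNER NON-TORSION FROM THE ANALYTIC RANKS (Gross–Zagier 1986 Thm. I.6.3 with V.§2; Gross 1991 (1.1):
«`y_K` has infinite order iff `L'(E/K,1) ≠ 0`»; `ord_{s=1} L(E/K,s) = r_an(E) + r_an(E^{(d_K)})`). For `E/ℚ` (globally
minimal `W`), `K` imaginary quadratic with the Heegner hypothesis for `N_E`, `r_an(E) = 0` and `r_an(E^{(d_K)}) = 1`,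
every conductor-`1` Kolyvagin–Heegner datum has `P(1) = y_K` of infinite order. IN PRINT; in the tree modulo the
named facts `gross_zagier` ∕ `hasEntireLFunction_rat` (`analyticRankEK_eq_add_holds_of`,
`analyticRankEK_eq_one_iff_heegner_nonTorsion_of`, `heegnerSystem_exists_isHeegnerPoint_map_eq_derivedPoint_one` with
`heegnerPointOfConductor_one_galoisConj_holds`). [cite: GrossZagier1986, Thm. I.6.3 with V.§2]
[cite: GrossLMS1991, §1 (1.1) and §4 (P_1 = y_K)] -/
theorem stub_heegnerNonTorsionAtTwo :
  ∀ (W : WeierstrassCurve ℚ) [W.IsElliptic] [W.IsGloballyMinimal] [NeZero (W.conductorNorm ℤ)]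
    (K : Type) [Field K] [NumberField K],
    IsImaginaryQuadratic K → SatisfiesHeegnerHypothesis (W.conductorNorm ℤ) K →
    W.analyticRank = 0 → (W.quadraticTwist (NumberField.discr K : ℚ)).analyticRank = 1 →
    ∀ (Dt : ModularParametrizationData W (W.conductorNorm ℤ)) (β : ℤ) (ι : K →+* ℂ)
      (d₁ : KolyvaginHeegnerData Dt β ι 1), ¬ IsOfFinAddOrder d₁.derivedPoint
    := by
  sorry

/-- STUB C (v2.2, LEAD gk2-p1 g18: the witness primes are asked in GROSS currency — `Zhang ∧ 2 ≤ kolyvaginIndex ∧ FrobEqFrobInfty W K 2` (Gross (3.3); `ℓ ≡ 3 (4)` inert with `Frob_ℓ = Frob_∞` on `K(E[2])`) — the input currency of LINE 18's Kolyvagin system (stub KS of `Cruxes/PowDvdShaCardAtTwoRT/Lines/plus_descent.lean`) and of the pen's option (β″); costs the supply nothing: such primes exist beyond every bound with every genus side condition, gk2-p5 g20 `GenusKolyTwistingPrime.exists_prime_heegnerField_minimalTwin_depth_supply_genusBudget_one` p710804, and the genus dictionary is level-agnostic) — GENUS 2-PRIMITIVITY OF THE HEEGNER KOLYVAGIN SYSTEM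 (the heart: Gross's Question 11 at `p = 2`,
book:editornd-l-functions-arithmetic p. 232, with a `2`-Selmer-minimal twin). For `E` in H (non-CM, `r_an = 0`,
`ρ_{E,2^n}` onto for all `n ≥ 1`, odd Tamagawa product), `K` imaginary quadratic with odd `d_K ≠ −3`, the Heegner
hypothesis and Kolyvagin's (H2) exclusions, an optimal parametrisation datum `Dt` with odd Manin constant, an
orientation `β`, an embedding `ι`, a conductor-`1` datum `d₁` with `y_K = P(1)` of infinite order, and a globally
minimal model `Wd ≅ E^{(d_K)}` of analytic rank `1` with `#Sel₂(Wd) = 2`: SOME square-free product `n` of Kolyvagin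
primes at `2` (`ℓ ∤ N·d_K`, `ℓ` inert, `2 ∣ ℓ + 1`, `2 ∣ a_ℓ`) carries a datum `d` with `P(n) ∉ 2E(K[n])`.
Mechanism foreseen by the route: `2·D_ℓ ≡ Tr − Σ(−1)^i σ^i (mod 4)` (the Kolyvagin derivative IS the genus projector
mod 2), so `2P(ℓ) ≡ a_ℓ y_K − Y_χ (mod 4E(K[ℓ]))` with `Y_χ` the genus Heegner point of conductor `ℓ`, and
«`P(ℓ) ∉ 2E`» becomes the odd Heegner index of the genus pair `(E^{(ℓ*)}, E^{(d_K ℓ*)})`, `2`-Selmer-minimal after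
Mazur–Rubin prime twisting. OPEN (W. Zhang 2014 is `p ≥ 5`; no Bertolini–Darmon admissible primes at `2`).
[cite: GrossLMS1991, §3 (3.5), §4 (4.1)] [cite: WZhang2014, Thm. 1.1 (p ≥ 5)] -/
theorem stub_genusPrimitivityAtTwo :
  ∀ (W : WeierstrassCurve ℚ) [W.IsElliptic] [W.IsGloballyMinimal] [NeZero (W.conductorNorm ℤ)],
    ¬ W.HasCM → W.analyticRank = 0 → (∀ n : ℕ, 0 < n → W.HasSurjectiveModNGaloisRep ((2 : ℤ) ^ n)) →
    Odd W.tamagawaProduct →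
    ∀ (K : Type) [Field K] [NumberField K],
    IsImaginaryQuadratic K → Odd (NumberField.discr K) → NumberField.discr K ≠ -3 →
    SatisfiesHeegnerHypothesis (W.conductorNorm ℤ) K →
    ¬ IsSquare ((NumberField.discr K : ℚ) * -|W.Δ|) → ¬ IsSquare ((NumberField.discr K : ℚ) * (-(2 * |W.Δ|))) →
    ∀ (Dt : ModularParametrizationData W (W.conductorNorm ℤ)),
    (∀ z ∈ Dt.L.lattice, ∃ w ∈ periodLattice Dt.f, z = (Dt.c : ℂ) * w) → Odd Dt.c →
    ∀ (β : ℤ) (ι : K →+* ℂ) (d₁ : KolyvaginHeegnerData Dt β ι 1), ¬ IsOfFinAddOrder d₁.derivedPoint →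
    ∀ (Wd : WeierstrassCurve ℚ) [Wd.IsElliptic] [Wd.IsGloballyMinimal],
    (∃ C : WeierstrassCurve.VariableChange ℚ, C • W.quadraticTwist (NumberField.discr K : ℚ) = Wd) →
    Wd.analyticRank = 1 → Nat.card (Wd.selmerGroup 2) = 2 → padicValNat 2 Wd.tamagawaProduct ≤ 2 →
    ∃ (n : ℕ) (d : KolyvaginHeegnerData Dt β ι n), Squarefree n ∧
      (∀ ℓ ∈ n.primeFactors, Zhang2014.IsKolyvaginPrime (W.conductorNorm ℤ) W K 2 ℓ ∧ 2 ≤ Zhang2014.kolyvaginIndex W 2 ℓ ∧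
        FrobEqFrobInfty W K 2 ℓ) ∧
      ¬ ∃ Q : (W.baseChange (ringClassField K ι n)).toAffine.Point, (2 : ℤ) • Q = d.derivedPoint
    := by
  sorry

/-! ## §2 Glue (proved) -/

/-- **McCallum's `M₀ = ord₂(y_K)` exists** (McCallum 1991 §5, proof of Lemma 5.1: «`M_0` is finite»): a point of
infinite order of `E(K[1])` has an exact `2`-divisibility exponent, because `K[1]` is a number field (Cox Prop. 13.2,
`numberField_ringClassField`) and `E(K[1])` is finitely generated (Mordell–Weil, `module_finite_point_holds`).
[cite: McCallumLMS1991, §5 Lemma 5.1 proof (p. 303)] -/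
theorem exists_exactTwoDivisibility_derivedPoint_one
    (W : WeierstrassCurve ℚ) [W.IsElliptic] {K : Type} [Field K] [NumberField K] (hK : IsImaginaryQuadratic K)
    {N : ℕ} [NeZero N] (Dt : ModularParametrizationData W N) (β : ℤ) (ι : K →+* ℂ)
    (d₁ : KolyvaginHeegnerData Dt β ι 1) (hy : ¬ IsOfFinAddOrder d₁.derivedPoint) :
    ∃ M₀ : ℕ, (∃ Q : (W.baseChange (ringClassField K ι 1)).toAffine.Point,
        ((2 ^ M₀ : ℕ) : ℤ) • Q = d₁.derivedPoint) ∧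
      ¬ ∃ Q : (W.baseChange (ringClassField K ι 1)).toAffine.Point,
        ((2 ^ (M₀ + 1) : ℕ) : ℤ) • Q = d₁.derivedPoint := by
  haveI : NumberField (ringClassField K ι 1) := numberField_ringClassField hK ι one_ne_zero
  haveI : (W.baseChange (ringClassField K ι 1)).IsElliptic := by rw [baseChange]; infer_instance
  haveI : Module.Finite ℤ (W.baseChange (ringClassField K ι 1)).toAffine.Point := by
    convert (W.baseChange (ringClassField K ι 1)).module_finite_point_holds
  exact exists_pow_smul_eq_and_not_of_not_isOfFinAddOrder Nat.prime_two hy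

/-- **The orientation exists under the Heegner hypothesis** (Gross 1984 §3; Gross–Zagier 1986 I.§3: `D ≡ β² (mod 4N)`):
bookkeeping over `exists_dvd_sq_sub_discr_of_ncard_primesOver`. [cite: Gross1984, §3] -/
theorem exists_orientation (W : WeierstrassCurve ℚ) [NeZero (W.conductorNorm ℤ)] {K : Type} [Field K]
    [NumberField K] (hK : IsImaginaryQuadratic K) (hH : SatisfiesHeegnerHypothesis (W.conductorNorm ℤ) K) :
    ∃ β : ℤ, (4 * (W.conductorNorm ℤ : ℕ) : ℤ) ∣ β ^ 2 - NumberField.discr K :=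
  Literature.NumberTheory.QuadraticFields.Quadratic.exists_dvd_sq_sub_discr_of_ncard_primesOver hK.1
    (NeZero.ne _) hH

/-- **The twin is non-CM**: a model `Wd ≅ E^{(d)}` of a quadratic twist of a non-CM curve is non-CM, since
`j(Wd) = j(E^{(d)}) = j(E)` (Silverman AEC X.5.4, III.1.4(b)) and `HasCM` depends only on `j` (`hasCM_iff_of_j_eq`).
[cite: SilvermanAEC2009, X.5 Cor. 5.4 with III.1.4(b)] -/
theorem not_hasCM_twin (W : WeierstrassCurve ℚ) [W.IsElliptic] (hcm : ¬ W.HasCM) {d : ℚ} (hd : d ≠ 0)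
    (Wd : WeierstrassCurve ℚ) [Wd.IsElliptic]
    (hWd : ∃ C : WeierstrassCurve.VariableChange ℚ, C • W.quadraticTwist d = Wd) : ¬ Wd.HasCM := by
  haveI := W.isElliptic_quadraticTwist hd
  obtain ⟨C, rfl⟩ := hWd
  have hj : (C • W.quadraticTwist d).j = W.j := by
    rw [WeierstrassCurve.variableChange_j, W.j_quadraticTwist hd]
  exact fun h ↦ hcm ((hasCM_iff_of_j_eq hj).mp h)

/-! ## §3 Composition -/

/-- COMPOSITION (v1): A gives `K` and the twin `Wd` (non-CM by glue); the habitat gives the optimal odd-Manin `Dt`;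
`β`, `ι`, the conductor-`1` datum `d₁` exist (glue); `r_an(E^{(d_K)}) = r_an(Wd) = 1` (model invariance); B gives
`y_K` of infinite order; `M₀` exists (glue); C gives the `2`-primitive `P(n)`. Concludes the route crux BY NAME; sorry-free
outside the three stubs. -/
theorem GenusDeepSupplyAtTwoNegDisc_of :
    Summit.BirchSwinnertonDyer.BirchSwinnertonDyer.Theses.GenusKolyvaginAtTwo.GenusDeepSupplyAtTwoNegDisc := by
  intro W _ _ _ hcm hr0 hρ hT _hneg hopt
  obtain ⟨K, iF, iN, hIQ, hodd, h3, hHe, hsq1, hsq2, Wd, iE, iM, hWd, hrd, hSel, hDEF⟩ :=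
    stub_minimalTwinSupplyAtTwo W hcm hr0 hρ hT
  obtain ⟨Dt, hoptDt, hc⟩ := hopt
  -- the orientation, the embedding, the conductor-`1` datum
  obtain ⟨β, hβ⟩ := exists_orientation W hIQ hHe
  obtain ⟨ι⟩ : Nonempty (K →+* ℂ) := inferInstance
  obtain ⟨d₁⟩ := exists_kolyvaginHeegnerData_one
    (phi_heegnerTau_mem_singularModuliField_holds (W.conductorNorm ℤ) W K) hIQ Dt β ι hβ
  -- the analytic rank of the twist is that of its minimal model
  have hd : (NumberField.discr K : ℚ) ≠ 0 := by exact_mod_cast NumberField.discr_ne_zero K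
  haveI := W.isElliptic_quadraticTwist hd
  have hcmd : ¬ Wd.HasCM := not_hasCM_twin W hcm hd Wd hWd
  have hrtw : (W.quadraticTwist (NumberField.discr K : ℚ)).analyticRank = 1 := by
    obtain ⟨C, hC⟩ := hWd
    rw [← analyticRank_smul (W.quadraticTwist (NumberField.discr K : ℚ)) C, hC]
    exact hrd
  -- `y_K` has infinite order (B) and its exponent `M₀` exists
  have hy : ¬ IsOfFinAddOrder d₁.derivedPoint := stub_heegnerNonTorsionAtTwo W K hIQ hHe hr0 hrtw Dt β ι d₁
  obtain ⟨M₀, hdiv, hndiv⟩ := exists_exactTwoDivisibility_derivedPoint_one W hIQ Dt β ι d₁ hy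
  -- the `2`-primitive derived point (C)
  obtain ⟨n, d, hn, hKoly, hPn⟩ := stub_genusPrimitivityAtTwo W hcm hr0 hρ hT K hIQ hodd h3 hHe hsq1 hsq2 Dt hoptDt
    hc β ι d₁ hy Wd hWd hrd hSel hDEF
  -- 23660 `GenusDeepSupplyAtTwoNegDisc` (rev 36/37, (β″)): the conclusion asks the GROSS clause — stub C delivers it whole; the `W.Δ < 0` binder is unused here.
  exact ⟨K, iF, iN, hIQ, hodd, h3, hHe, hsq1, hsq2, Dt, β, ι, d₁, hoptDt, hc, hy, M₀, hdiv, hndiv, n, d, hn, hKoly, hPn,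
    Wd, iE, iM, hWd, hcmd, hrd, hSel⟩

end Summit.BirchSwinnertonDyer.BirchSwinnertonDyer.Cruxes.GenusDeepSupplyAtTwoNegDisc.GenusSupply

end
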